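import Mathlib
import Summits.ValiantsHypothesis.ValiantsHypothesis.Theorems.SymPencilSymmetrizePermPairsPermEmbeddingDSubPrelim
import Summits.ValiantsHypothesis.ValiantsHypothesis.Theorems.SymPencilSymmetrizePermPairsSmallIndexSymmetricCore
import Summits.ValiantsHypothesis.ValiantsHypothesis.Theorems.SymPencilSymmetrizePermPairsSpinTwoDegree
import Summits.ValiantsHypothesis.ValiantsHypothesis.Theorems.SymPencilSymmetrizePermPairsYoungTwoDegree
import HarnessLib

/-!
# ValiantsHypothesis / SymPencil — crux `SymmetrizePermPairs` (stmt-ValiantsHypothesis-17793),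
# stub `stub_induce`, ASSEMBLY [A1′]: (D)_H from the group step (GS) ALONE — the two-degree spin
# dichotomy at the SYMMETRIC level (`SpinDichotomy.spinDichotomy_two_degree`, p7) through the signed
# symmetric core (`SmallIndex.exists_symmetric_core`, p7) and the two-degree Young fixed vectors
# (`YoungBounds.youngFixedVector_two_holds`, p6) — merged-desk RULING #181

`permEmbeddingD_sub_of_GS : (GS) → (D)_H`.  Compared with `permEmbeddingD_sub_of_bounds`
(`…PermEmbeddingDSub.lean`, binders (H1)₂ at the 𝔄-level and (H2)₂), regime (C) runs on the
symmetric core: after (GS) gives `Alt(Ω∖X₁) × Alt(Ω∖X₂) ≤ φ(G)`, the signed embeddings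
`j : 𝔖_{a₁} × 𝔖_{a₂} ↪ Alt(Ω∖X₁) × Alt(Ω∖X₂)` (`a_i = n − |X_i| − 2`, index `≤ n^{|X₁|+|X₂|+4}`) give
`E = φ⁻¹(j(𝔖_{a₁} × 𝔖_{a₂}))` of index `≤ n^{2k₀+2}` with `ψ : E ↠ 𝔖_{a₁} × 𝔖_{a₂}`
(`MonoidHom.ofInjective`), same scalar kernel; `spinDichotomy_two_degree ψ` either returns to the
large regime (`n ≤ 8(log₂ k + 1)`) or de-twists by `θ` on `E₀ = ψ⁻¹(𝔄_{a₁} × 𝔄_{a₂})` (index `≤ 4`;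
`[E₀ : ker θ] ≤ M` by perfectness); `youngFixedVector_two_holds` on the descended representation of
`𝔄_{a₁} × 𝔄_{a₂}`; `L = (Y.comap ψ_A ⊓ ker θ) ≤ E₀ ≤ E ≤ G`; `permRetract_frobenius`.
(GS) is `SmallIndex.prod_altFixing_le_of_small_index` at `α = Fin n` (filed separately).

Honest framing: assembly for an OPEN stub of an OPEN crux; the induced-block step (I1) and the
symmetric-output core (C3) are untouched; `VP ≠ VNP` is NOT proved and nothing here is progress on
it.  No new definitions, no named facts (`--supports stmt-ValiantsHypothesis-17793 --as helper`).
-/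

noncomputable section

-- `Summit.ValiantsHypothesis.ValiantsHypothesis.…` is the tree's mandated single-conjunct layout
-- (Sub = Summit), so the duplicated namespace component is intended.
set_option linter.dupNamespace false

namespace Summit.ValiantsHypothesis.ValiantsHypothesis.Theorems.SymPencilEquivariantSdcNotQP

open Matrix Equiv Equiv.Perm


open PermEmbeddingSub YoungBounds

/-- `[𝔖_a × 𝔖_b : 𝔄_a × 𝔄_b] ≤ 4`. [folklore] -/
theorem PermEmbeddingSub.index_alternating_prod_le₂ (a b : ℕ) :
    ((alternatingGroup (Fin a)).prod (alternatingGroup (Fin b))).index ≤ 4 := by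
  have h2 : ∀ m : ℕ, (alternatingGroup (Fin m)).index ≤ 2 := by
    intro m
    rw [alternatingGroup, Subgroup.index_ker]
    calc Nat.card (Equiv.Perm.sign (α := Fin m)).range ≤ Nat.card ℤˣ :=
          Nat.card_le_card_of_injective _ (Subgroup.subtype_injective _)
      _ = 2 := by rw [Nat.card_eq_fintype_card, Fintype.card_units_int]
  rw [Subgroup.index_prod]
  calc (alternatingGroup (Fin a)).index * (alternatingGroup (Fin b)).index ≤ 2 * 2 :=
        Nat.mul_le_mul (h2 a) (h2 b)
    _ = 4 := by norm_num

/-! ### [A1′] (D)_H from (GS) -/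

/-- **(D)_H ⇐ (GS).**  The irreducible permutation embedding for a finite group `G` mapping (not
necessarily onto) to `𝔖_n × 𝔖_n`, scalar with `M`-th roots of unity on the kernel, with budget
quasi-polynomial in `M`, `n` and the index of the image — from the group step (GS) (hypothesis,
verbatim the shape of `SmallIndex.prod_altFixing_le_of_small_index` at `α = Fin n`), the landed
symmetric-level two-degree spin dichotomy `SpinDichotomy.spinDichotomy_two_degree` run on the signed
symmetric core `SmallIndex.exists_symmetric_core`, and the landed two-degree Young fixed vectors
`YoungBounds.youngFixedVector_two_holds`.  See the module docstring for the regimes.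
`stub_induce`, the crux `SymmetrizePermPairs` and `VP ≠ VNP` remain OPEN. [folklore] -/
theorem permEmbeddingD_sub_of_GS
    (hGS : ∀ (n : ℕ) (I : Subgroup (Perm (Fin n) × Perm (Fin n))) (k₀ : ℕ),
      8 < n → 1 ≤ k₀ → 4 * k₀ ≤ n → I.index < n.choose k₀ → 2 * I.index < (n - k₀).factorial →
      ∃ X₁ X₂ : Finset (Fin n), X₁.card < k₀ ∧ X₂.card < k₀ ∧
        ((alternatingGroup {x // x ∉ X₁}).map
            (Equiv.Perm.ofSubtype : Perm {x // x ∉ X₁} →* Perm (Fin n))).prod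
          ((alternatingGroup {x // x ∉ X₂}).map
            (Equiv.Perm.ofSubtype : Perm {x // x ∉ X₂} →* Perm (Fin n))) ≤ I) :
    ∃ d : ℕ, ∀ (n M k : ℕ) (G : Type) [Group G] [Finite G]
      (φ : G →* Perm (Fin n) × Perm (Fin n)) (ρ : G →* GL (Fin k) ℂ),
      (∀ g : G, φ g = 1 → ∃ c : ℂ, c ^ M = 1 ∧
        (ρ g : Matrix (Fin k) (Fin k) ℂ) = c • (1 : Matrix (Fin k) (Fin k) ℂ)) →
      k ≤ M →
      (∀ W : Submodule ℂ (Fin k → ℂ),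
        (∀ g : G, W ≤ W.comap (Matrix.toLin' (ρ g : Matrix (Fin k) (Fin k) ℂ))) → W = ⊥ ∨ W = ⊤) →
      ∃ m' ≤ 2 ^ ((Nat.log 2 M + Nat.log 2 n + Nat.log 2 φ.range.index + d) ^ d),
        ∃ (ι : Matrix (Fin m') (Fin k) ℂ) (p : Matrix (Fin k) (Fin m') ℂ) (τ : G → Perm (Fin m')),
          p * ι = 1 ∧ ∀ g : G,
            (τ g).permMatrix ℂ * ι = ι * (ρ g : Matrix (Fin k) (Fin k) ℂ) ∧
            p * (τ g).permMatrix ℂ = (ρ g : Matrix (Fin k) (Fin k) ℂ) * p := by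
  classical
  obtain ⟨c, hc⟩ := YoungBounds.youngFixedVector_two_holds
  obtain ⟨a', ha'1, ha'2⟩ : ∃ a' : ℕ, 8 ≤ a' ∧ 4 ≤ a' := ⟨8, le_rfl, by norm_num⟩
  obtain ⟨d, hd1, hd2, hd3⟩ : ∃ d : ℕ, 2 * a' + 3 ≤ d ∧ 27 ≤ d ∧ c + 5 ≤ d :=
    ⟨2 * a' + 3 + 27 + (c + 5), by omega, by omega, by omega⟩
  refine ⟨d, fun n M k G _ _ φ ρ hker hkM hirr => ?_⟩
  set R : ℕ := φ.range.index with hR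
  set Bd : ℕ := 2 ^ ((Nat.log 2 M + Nat.log 2 n + Nat.log 2 R + d) ^ d) with hBd
  -- `k = 0`: everything is a `Fin 0`-indexed matrix
  rcases Nat.eq_zero_or_pos k with hk0 | hk
  · subst hk0
    refine ⟨0, Nat.zero_le _, 0, 0, fun _ => 1, ?_, fun g => ⟨?_, ?_⟩⟩
    · ext i; exact Fin.elim0 i
    · ext i; exact Fin.elim0 i
    · ext i; exact Fin.elim0 i
  have hM : M ≠ 0 := by omega
  -- common end: a subgroup fixing a nonzero functional, of index within budget
  have finish : ∀ (L : Subgroup G) (ℓ : (Fin k → ℂ) →ₗ[ℂ] ℂ), ℓ ≠ 0 →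
      (∀ l ∈ L, ℓ ∘ₗ Matrix.toLin' (ρ l : Matrix (Fin k) (Fin k) ℂ) = ℓ) → L.index ≤ Bd →
      ∃ m' ≤ Bd,
        ∃ (ι : Matrix (Fin m') (Fin k) ℂ) (p : Matrix (Fin k) (Fin m') ℂ) (τ : G → Perm (Fin m')),
          p * ι = 1 ∧ ∀ g : G,
            (τ g).permMatrix ℂ * ι = ι * (ρ g : Matrix (Fin k) (Fin k) ℂ) ∧
            p * (τ g).permMatrix ℂ = (ρ g : Matrix (Fin k) (Fin k) ℂ) * p := by
    intro L ℓ hℓ0 hℓL hidx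
    obtain ⟨m', ι, p, τ, hm', hpι, hrel⟩ := permRetract_frobenius G L k ρ ℓ hirr hℓ0 hℓL
    exact ⟨m', hm' ▸ hidx, ι, p, τ, hpι, hrel⟩
  -- through `ker ρ`, whenever `(n!)² M` is within budget
  have viaKer : Nat.card (Perm (Fin n) × Perm (Fin n)) * M ≤ Bd →
      ∃ m' ≤ Bd,
        ∃ (ι : Matrix (Fin m') (Fin k) ℂ) (p : Matrix (Fin k) (Fin m') ℂ) (τ : G → Perm (Fin m')),
          p * ι = 1 ∧ ∀ g : G,
            (τ g).permMatrix ℂ * ι = ι * (ρ g : Matrix (Fin k) (Fin k) ℂ) ∧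
            p * (τ g).permMatrix ℂ = (ρ g : Matrix (Fin k) (Fin k) ℂ) * p := by
    intro hbud
    set i₀ : Fin k := ⟨0, hk⟩ with hi₀
    refine finish ρ.ker (LinearMap.proj i₀) ?_ ?_ ?_
    · intro h
      have := LinearMap.congr_fun h (Pi.single i₀ (1 : ℂ))
      simp at this
    · intro l hl
      rw [MonoidHom.mem_ker] at hl
      rw [hl, Units.val_one, Matrix.toLin'_one, LinearMap.comp_id]
    · exact (index_ker_le_card_mul hk M hM φ ρ hker).trans hbud
  -- regime (A): `n` small against `log₂ k`
  have large : n ≤ a' * (Nat.log 2 k + 1) →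
      ∃ m' ≤ Bd,
        ∃ (ι : Matrix (Fin m') (Fin k) ℂ) (p : Matrix (Fin k) (Fin m') ℂ) (τ : G → Perm (Fin m')),
          p * ι = 1 ∧ ∀ g : G,
            (τ g).permMatrix ℂ * ι = ι * (ρ g : Matrix (Fin k) (Fin k) ℂ) ∧
            p * (τ g).permMatrix ℂ = (ρ g : Matrix (Fin k) (Fin k) ℂ) * p := by
    intro hn
    refine viaKer ?_
    have hn' : n ≤ a' * (Nat.log 2 M + 1) :=
      hn.trans (Nat.mul_le_mul_left _ (Nat.succ_le_succ (Nat.log_mono_right hkM)))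
    calc Nat.card (Perm (Fin n) × Perm (Fin n)) * M
        ≤ 2 ^ ((Nat.log 2 M + Nat.log 2 n + (2 * a' + 3)) ^ (2 * a' + 3)) := budget_large a' n M hn'
      _ ≤ Bd := qp_mono (Nat.le_add_right _ _) hd1 (by omega)
  by_cases hA : n ≤ a' * (Nat.log 2 k + 1)
  · exact large hA
  -- regime (B): `n` small against `log₂ R`
  set k₀ : ℕ := Nat.log 2 R + 1 with hk₀
  by_cases hB : n ≤ 4 * k₀ + 8
  · refine viaKer ?_
    obtain ⟨M', hM'1, hM'2, hM'3⟩ :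
        ∃ M' : ℕ, M ≤ M' ∧ R ≤ M' ∧ Nat.log 2 M' ≤ Nat.log 2 M + Nat.log 2 R :=
      ⟨max M R, le_max_left _ _, le_max_right _ _, log_max_le M R⟩
    have hn' : n ≤ 12 * (Nat.log 2 M' + 1) := by
      have : Nat.log 2 R ≤ Nat.log 2 M' := Nat.log_mono_right hM'2
      omega
    have hx : Nat.log 2 M' + Nat.log 2 n ≤ Nat.log 2 M + Nat.log 2 n + Nat.log 2 R := by omega
    calc Nat.card (Perm (Fin n) × Perm (Fin n)) * M
        ≤ Nat.card (Perm (Fin n) × Perm (Fin n)) * M' := Nat.mul_le_mul_left _ hM'1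
      _ ≤ 2 ^ ((Nat.log 2 M' + Nat.log 2 n + (2 * 12 + 3)) ^ (2 * 12 + 3)) := budget_large 12 n M' hn'
      _ ≤ Bd := qp_mono hx hd2 (by norm_num)
  -- regime (C): the group step applies with `k₀ = log₂ R + 1`
  rw [not_le] at hA hB
  have hRpos : 0 < R := Nat.pos_of_ne_zero Subgroup.index_ne_zero_of_finite
  have hRlt : R < 2 ^ k₀ := Nat.lt_pow_succ_log_self one_lt_two R
  have hidx : φ.range.index < n.choose k₀ :=
    lt_of_lt_of_le hRlt (two_pow_le_choose (by omega))
  have hidx2 : 2 * φ.range.index < (n - k₀).factorial := by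
    have h1 : 2 * R < 2 ^ (k₀ + 1) := by rw [pow_succ]; omega
    have h2 : 2 ^ (k₀ + 1) ≤ 2 ^ (n - k₀ - 1) := Nat.pow_le_pow_right (by norm_num) (by omega)
    have h3 : 2 ^ (n - k₀ - 1) ≤ (n - k₀ - 1 + 1).factorial :=
      Literature.Computability.Cryptography.BLPRS2013.two_pow_le_factorial_succ _
    have h4 : n - k₀ - 1 + 1 = n - k₀ := by omega
    rw [h4] at h3
    exact lt_of_lt_of_le h1 (h2.trans h3)
  obtain ⟨X₁, X₂, hX₁, hX₂, hle⟩ := hGS n φ.range k₀ (by omega) (by omega) (by omega) hidx hidx2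
  -- the signed symmetric core `j : 𝔖_{a₁} × 𝔖_{a₂} ↪ Alt(Ω∖X₁) × Alt(Ω∖X₂) ≤ φ(G)`
  obtain ⟨a₁, a₂, j, ha₁, ha₂, hjinj, hjle, hjidx⟩ :=
    SmallIndex.exists_symmetric_core X₁ X₂ (by omega) (by omega)
  have hjφ : j.range ≤ φ.range := hjle.trans hle
  set E : Subgroup G := j.range.comap φ with hE
  -- the index of `E`
  have hn1 : 1 ≤ n := by omega
  have hEidx : E.index ≤ n ^ (2 * k₀ + 2) := by
    have h1 : E.index * R = j.range.index := by
      rw [hE, Subgroup.index_comap, hR, Subgroup.relIndex_mul_index hjφ]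
    calc E.index ≤ E.index * R := Nat.le_mul_of_pos_right _ hRpos
      _ ≤ n ^ (X₁.card + X₂.card + 4) := h1 ▸ hjidx
      _ ≤ n ^ (2 * k₀ + 2) := Nat.pow_le_pow_right hn1 (by omega)
  -- the two degrees
  have ha5 : 5 ≤ a₁ := by omega
  have hb5 : 5 ≤ a₂ := by omega
  have hmaxn : max a₁ a₂ ≤ n := by omega
  have hmin : n ≤ 2 * min a₁ a₂ := by omega
  -- `ψ : E ↠ 𝔖_{a₁} × 𝔖_{a₂}` through `j`
  let ej : (Perm (Fin a₁) × Perm (Fin a₂)) ≃* ↥j.range := MonoidHom.ofInjective hjinj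
  let ψ₀ : E →* ↥j.range := (φ.comp E.subtype).codRestrict j.range (fun g => g.2)
  let ψ : E →* Perm (Fin a₁) × Perm (Fin a₂) := ej.symm.toMonoidHom.comp ψ₀
  have hψj : ∀ g : E, j (ψ g) = φ (g : G) := fun g =>
    MonoidHom.apply_ofInjective_symm hjinj (ψ₀ g)
  have hψ_surj : Function.Surjective ψ := by
    intro y
    obtain ⟨g, hg⟩ : j y ∈ φ.range := hjφ ⟨y, rfl⟩
    have hgE : g ∈ E := by rw [hE, Subgroup.mem_comap, hg]; exact ⟨y, rfl⟩
    refine ⟨⟨g, hgE⟩, hjinj ?_⟩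
    rw [hψj, Subgroup.coe_mk, hg]
  have hψ_ker : ∀ g : E, ψ g = 1 ↔ φ (g : G) = 1 := by
    intro g
    rw [← hψj]
    constructor
    · intro h; rw [h, map_one]
    · intro h; exact hjinj (by rw [h, map_one])
  -- the index-`≤ 4` subgroup `E₀ = ψ⁻¹(𝔄_{a₁} × 𝔄_{a₂})` (introduced BEFORE `θ`, whose type mentions it)
  set AA : Subgroup (Perm (Fin a₁) × Perm (Fin a₂)) :=
    (alternatingGroup (Fin a₁)).prod (alternatingGroup (Fin a₂)) with hAA
  set E₀ : Subgroup E := AA.comap ψ with hE₀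
  have hE₀idx : E₀.index ≤ 4 := by
    rw [hE₀, Subgroup.index_comap_of_surjective _ hψ_surj]
    exact PermEmbeddingSub.index_alternating_prod_le₂ a₁ a₂
  -- the restricted representation and the symmetric-level spin dichotomy
  let σ : E →* GL (Fin k) ℂ := ρ.comp E.subtype
  have hσ : ∀ g : E, σ g = ρ (g : G) := fun g => rfl
  have hσker : ∀ g : E, ψ g = 1 → ∃ c : ℂ,
      (σ g : Matrix (Fin k) (Fin k) ℂ) = c • (1 : Matrix (Fin k) (Fin k) ℂ) := by
    intro g hg
    obtain ⟨c', -, hc'⟩ := hker g ((hψ_ker g).mp hg)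
    exact ⟨c', hc'⟩
  rcases SpinDichotomy.spinDichotomy_two_degree ψ σ hψ_surj hσker with hsmall | ⟨θ, hθ⟩
  · refine large ?_
    calc n ≤ 2 * min a₁ a₂ := hmin
      _ ≤ 2 * (4 * (Nat.log 2 k + 1)) := Nat.mul_le_mul_left _ hsmall
      _ = 8 * (Nat.log 2 k + 1) := by ring
      _ ≤ a' * (Nat.log 2 k + 1) := Nat.mul_le_mul_right _ ha'1
  -- `ψA : E₀ ↠ 𝔄_{a₁} × 𝔄_{a₂}` on the index-`≤ 4` subgroup `E₀ = ψ⁻¹(𝔄_{a₁} × 𝔄_{a₂})`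
  let ψA₀ : E₀ →* AA := (ψ.comp E₀.subtype).codRestrict AA (fun g => g.2)
  let ψA : E₀ →* ↥(alternatingGroup (Fin a₁)) × ↥(alternatingGroup (Fin a₂)) :=
    (Subgroup.prodEquiv (alternatingGroup (Fin a₁)) (alternatingGroup (Fin a₂))).toMonoidHom.comp ψA₀
  have hψA_surj : Function.Surjective ψA := by
    intro x
    obtain ⟨y, hy⟩ :=
      (Subgroup.prodEquiv (alternatingGroup (Fin a₁)) (alternatingGroup (Fin a₂))).surjective x
    obtain ⟨g, hg⟩ := hψ_surj (y : Perm (Fin a₁) × Perm (Fin a₂))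
    have hgmem : g ∈ E₀ := by rw [hE₀, Subgroup.mem_comap, hg]; exact y.2
    refine ⟨⟨g, hgmem⟩, ?_⟩
    rw [← hy]
    change (Subgroup.prodEquiv _ _) (ψA₀ ⟨g, hgmem⟩) = _
    congr 1
    apply Subtype.ext
    change ψ g = y
    exact hg
  have hψA_ker : ∀ g : E₀, ψA g = 1 ↔ ψ (g : E) = 1 := by
    intro g
    change (Subgroup.prodEquiv _ _) (ψA₀ g) = 1 ↔ _
    rw [MulEquiv.map_eq_one_iff, ← OneMemClass.coe_eq_one]
    exact Iff.rfl
  -- `θ` has order dividing `M` on `ker ψA`, hence `[E₀ : ker θ] ≤ M` by perfectness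
  have hθM : ∀ g : E₀, ψA g = 1 → θ g ^ M = 1 := by
    intro g hg
    have hg' : ψ (g : E) = 1 := (hψA_ker g).mp hg
    obtain ⟨c', hc'M, hc'⟩ := hker ((g : E) : G) ((hψ_ker _).mp hg')
    have e : ((θ g : ℂˣ) : ℂ) = c' :=
      (scalar_eq_apply ⟨0, hk⟩ (hθ g hg')).trans (scalar_eq_apply ⟨0, hk⟩ hc').symm
    apply Units.ext
    rw [Units.val_pow_eq_pow_val, e, hc'M, Units.val_one]
  have hθidx : θ.ker.index ≤ M :=
    index_ker_le_of_sup_eq_top ψA θ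
      (ker_sup_ker_eq_top_of_perfect (commutator_alternating_prod_eq_top₂ a₁ a₂ ha5 hb5) ψA hψA_surj θ)
      M hM hθM
  -- the twisted representation `σ' = θ⁻¹ σ` on `E₀`, trivial on `ker ψA`, and its descent
  let σ₀ : E₀ →* GL (Fin k) ℂ := σ.comp E₀.subtype
  have hσ₀ : ∀ g : E₀, σ₀ g = σ (g : E) := fun g => rfl
  let σ' : E₀ →* GL (Fin k) ℂ :=
    { toFun := fun g => ⟨((θ g)⁻¹ : ℂˣ).val • (σ₀ g : Matrix (Fin k) (Fin k) ℂ),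
        (θ g : ℂˣ).val • ((σ₀ g)⁻¹ : GL (Fin k) ℂ).val, by
          rw [Matrix.smul_mul, Matrix.mul_smul, smul_smul, Units.mul_inv, Units.inv_mul, one_smul], by
          rw [Matrix.smul_mul, Matrix.mul_smul, smul_smul, Units.inv_mul, Units.mul_inv, one_smul]⟩
      map_one' := by
        apply Units.ext
        simp only [map_one, inv_one, Units.val_one, one_smul]
      map_mul' := fun x y => by
        apply Units.ext
        simp only [map_mul, mul_inv, Units.val_mul, Matrix.smul_mul, Matrix.mul_smul, smul_smul]
        rw [mul_comm] }
  have hσ' : ∀ g, (σ' g : Matrix (Fin k) (Fin k) ℂ) =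
      ((θ g)⁻¹ : ℂˣ).val • (σ₀ g : Matrix (Fin k) (Fin k) ℂ) := fun g => rfl
  have hσ'ker : ψA.ker ≤ σ'.ker := by
    intro g hg
    rw [MonoidHom.mem_ker] at hg ⊢
    apply Units.ext
    rw [hσ', hσ₀, hθ g ((hψA_ker g).mp hg), smul_smul, Units.inv_mul, one_smul, Units.val_one]
  obtain ⟨σA, hσA⟩ :
      ∃ σA : (↥(alternatingGroup (Fin a₁)) × ↥(alternatingGroup (Fin a₂))) →* GL (Fin k) ℂ,
        ∀ g, σA (ψA g) = σ' g :=
    ⟨ψA.liftOfRightInverse (Function.surjInv hψA_surj) (Function.rightInverse_surjInv hψA_surj)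
        ⟨σ', hσ'ker⟩,
      fun g => MonoidHom.liftOfRightInverse_comp_apply ψA (Function.surjInv hψA_surj)
        (Function.rightInverse_surjInv hψA_surj) ⟨σ', hσ'ker⟩ g⟩
  -- two-degree Young fixed vectors for the descended representation
  obtain ⟨Y, hYidx, ℓ, hℓ0, hℓY⟩ := hc a₁ a₂ k σA hk
  -- the subgroup `L = (Y.comap ψA ⊓ ker θ) ≤ E₀ ≤ E ≤ G` fixes `ℓ`
  set L : Subgroup G := ((Y.comap ψA ⊓ θ.ker).map E₀.subtype).map E.subtype with hL
  refine finish L ℓ hℓ0 ?_ ?_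
  · intro l hl
    obtain ⟨g₁, hg₁, rfl⟩ := Subgroup.mem_map.mp hl
    obtain ⟨g, hg, rfl⟩ := Subgroup.mem_map.mp hg₁
    obtain ⟨hgY, hgθ⟩ := Subgroup.mem_inf.mp hg
    rw [Subgroup.mem_comap] at hgY
    rw [MonoidHom.mem_ker] at hgθ
    have e : (ρ (E.subtype (E₀.subtype g)) : Matrix (Fin k) (Fin k) ℂ) =
        (σA (ψA g) : Matrix (Fin k) (Fin k) ℂ) := by
      rw [hσA, hσ', hgθ, inv_one, Units.val_one, one_smul, hσ₀, hσ, Subgroup.coe_subtype,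
        Subgroup.coe_subtype]
    rw [e]
    exact hℓY _ hgY
  · have h1 : L.index = (Y.comap ψA ⊓ θ.ker).index * E₀.index * E.index := by
      rw [hL, Subgroup.index_map_subtype, Subgroup.index_map_subtype]
    have h2 : (Y.comap ψA ⊓ θ.ker).index ≤ (Y.comap ψA).index * θ.ker.index := Subgroup.index_inf_le
    have h3 : (Y.comap ψA).index = Y.index := Subgroup.index_comap_of_surjective _ hψA_surj
    -- numerics
    have hn2 : n ≤ 2 ^ (Nat.log 2 n + 1) := (Nat.lt_pow_succ_log_self one_lt_two n).le
    have hnpow : n ^ (2 * k₀ + 2) ≤ 2 ^ ((Nat.log 2 n + 1) * (2 * k₀ + 2)) := by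
      calc n ^ (2 * k₀ + 2) ≤ (2 ^ (Nat.log 2 n + 1)) ^ (2 * k₀ + 2) := Nat.pow_le_pow_left hn2 _
        _ = 2 ^ ((Nat.log 2 n + 1) * (2 * k₀ + 2)) := (pow_mul _ _ _).symm
    have hM2 : M ≤ 2 ^ (Nat.log 2 M + 1) := (Nat.lt_pow_succ_log_self one_lt_two M).le
    have hY' : Y.index ≤ 2 ^ ((Nat.log 2 M + Nat.log 2 n + c) ^ c) := by
      refine hYidx.trans (Nat.pow_le_pow_right (by norm_num) (Nat.pow_le_pow_left ?_ c))
      have h4 : Nat.log 2 k ≤ Nat.log 2 M := Nat.log_mono_right hkM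
      have h5 : Nat.log 2 (max a₁ a₂) ≤ Nat.log 2 n := Nat.log_mono_right hmaxn
      omega
    have hexp := budget_main c (Nat.log 2 M) (Nat.log 2 n) (Nat.log 2 R + 1)
    calc L.index ≤ (Y.comap ψA).index * θ.ker.index * E₀.index * E.index := by
          rw [h1]; exact Nat.mul_le_mul_right _ (Nat.mul_le_mul_right _ h2)
      _ ≤ 2 ^ ((Nat.log 2 M + Nat.log 2 n + c) ^ c) * 2 ^ (Nat.log 2 M + 1) * 4 *
            2 ^ ((Nat.log 2 n + 1) * (2 * k₀ + 2)) := by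
          rw [h3]
          exact Nat.mul_le_mul (Nat.mul_le_mul (Nat.mul_le_mul hY' (hθidx.trans hM2)) hE₀idx)
            (hEidx.trans hnpow)
      _ = 2 ^ ((Nat.log 2 M + Nat.log 2 n + c) ^ c + (Nat.log 2 M + 1) +
            (2 + (Nat.log 2 n + 1) * (2 * (Nat.log 2 R + 1 + 1)))) := by
          rw [hk₀]
          ring
      _ ≤ 2 ^ ((Nat.log 2 M + Nat.log 2 n + (Nat.log 2 R + 1) + (c + 4)) ^ (c + 4)) :=
          Nat.pow_le_pow_right (by norm_num) hexp
      _ = 2 ^ ((Nat.log 2 M + Nat.log 2 n + Nat.log 2 R + (c + 5)) ^ (c + 4)) := by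
          congr 2; ring
      _ ≤ 2 ^ ((Nat.log 2 M + Nat.log 2 n + Nat.log 2 R + (c + 5)) ^ (c + 5)) :=
          Nat.pow_le_pow_right (by norm_num) (Nat.pow_le_pow_right (by omega) (by omega))
      _ ≤ Bd := qp_mono le_rfl hd3 (by omega)

end Summit.ValiantsHypothesis.ValiantsHypothesis.Theorems.SymPencilEquivariantSdcNotQP

end
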